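import Mathlib
import Literature.NumberTheory.Transcendental.KZCalculus
import Literature.NumberTheory.Transcendental.KZHomotopyMoves
import Literature.NumberTheory.Transcendental.KZProductIdeal
import Literature.NumberTheory.Transcendental.KZLogCalculusProofs
import Literature.NumberTheory.Transcendental.KZDominatedFamilyRelations
import Literature.NumberTheory.Transcendental.SemialgebraicLineDeriv

/-!
# `HyperellipticRiemannRelation` (stmt-KontsevichZagierPeriods-3522), line `SketchIdeator2`:
# auxiliary moves for the stub `stub_engine`

Two general move lemmas of the Kontsevich–Zagier calculus (`KZCalculus.lean`) over an arbitrary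
`ℚ`-semialgebraic base `S ⊆ ℝᵐ`, used by the fibred half-plane transport engine `stub_engine`
(file `UnfoldedStokesHyperellipticRiemannRelationStubEngine.lean`):

* `Engine.exists_lastSubst` — substitution `Ψ (y, t) = (y, c t)` along the last coordinate by a
  one-variable `ℚ`-semialgebraic `c` (semialgebraic derivative `c' > 0`, injective) is ONE
  rule-(2) move `[S × I, (f ∘ Ψ) · c'] ∼ [S × c(I), f]` (`det Ψ' = c'`, `LinearMap.det_of_snoc_init`;
  integrability by `MeasureTheory.integrableOn_image_iff_integrableOn_abs_det_fderiv_smul`);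
* `stub_engineAux` (registered auxiliary stub) — a band `S × (0,1)` whose fibre primitive
  tends to `0` at both ends is a relation: ONE Newton–Leibniz move (rule (3), primitive extended by
  zero to the closed fibres, edges `0 ≤ 1`, base integrand `0`) plus the two null faces (rule (1)).

Also recorded: the compactification `c t = (1 − t)⁻¹ − t⁻¹ : (0,1) → ℝ` (derivative, strict
monotonicity, surjectivity, limits `∓∞` at the ends). No definitions are introduced.
References: Kontsevich–Zagier 2001, §1.2 rules (1)–(3); Bochnak–Coste–Roy 1998, §2.2.
-/

noncomputable section

namespace Summit.KontsevichZagierPeriods.UnfoldedStokes.HyperellipticRiemannRelationLine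

open Set MeasureTheory Filter Topology
open Literature.NumberTheory.Transcendental
open Literature.ModelTheory.ExponentialFields (IsSemialgebraic)

namespace Engine

/-! ## Semialgebraic bookkeeping along the last coordinate -/

/-- The cylinder `{(y, t) | y ∈ S, t ∈ I}` over a `ℚ`-semialgebraic base with `ℚ`-semialgebraic
fibre `I ⊆ ℝ` is `ℚ`-semialgebraic. [folklore] -/
theorem isSemialgebraic_lastCyl {m : ℕ} {S : Set (Fin m → ℝ)} (hS : IsSemialgebraic ℚ S)
    {I : Set ℝ} (hI : IsSemialgebraic ℚ {p : Fin 1 → ℝ | p 0 ∈ I}) :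
    IsSemialgebraic ℚ {z : Fin (m + 1) → ℝ | Fin.init z ∈ S ∧ z (Fin.last m) ∈ I} :=
  hS.setOf_init_mem.inter (hI.preimage_comp fun _ : Fin 1 => Fin.last m)

/-- A one-variable `ℚ`-semialgebraic function read in the last coordinate is `ℚ`-semialgebraic
(composition with a coordinate projection). [cite: BochnakCosteRoy1998, Prop. 2.2.6] -/
theorem isSemialgebraicFunOn_comp_last {m : ℕ} {T : Set (Fin (m + 1) → ℝ)}
    (hT : IsSemialgebraic ℚ T) {I : Set ℝ} (φ : ℝ → ℝ)
    (hφ : IsSemialgebraicFunOn ℚ {p : Fin 1 → ℝ | p 0 ∈ I} (fun p => φ (p 0)))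
    (hTI : ∀ z ∈ T, z (Fin.last m) ∈ I) :
    IsSemialgebraicFunOn ℚ T (fun z => φ (z (Fin.last m))) := by
  have hπ : IsSemialgebraicMapOn ℚ T
      (fun z : Fin (m + 1) → ℝ => fun _ : Fin 1 => z (Fin.last m)) := by
    convert isSemialgebraicMapOn_aeval hT
      (fun _ : Fin 1 => (MvPolynomial.X (Fin.last m) : MvPolynomial (Fin (m + 1)) ℚ)) using 2 with z
    ext j
    simp
  exact IsSemialgebraicFunOn.comp_isSemialgebraicMapOn_holds hφ hπ fun z hz => hTI z hz

/-- The substitution `Ψ (y, t) = (y, c t)` along the last coordinate is a `ℚ`-semialgebraic map on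
the cylinder `S × I` when `c` is `ℚ`-semialgebraic on `I` (coordinatewise: polynomials and `c`).
[cite: BochnakCosteRoy1998, Prop. 2.2.6] -/
theorem isSemialgebraicMapOn_lastSubst {m : ℕ} {S : Set (Fin m → ℝ)} (hS : IsSemialgebraic ℚ S)
    {I : Set ℝ} (hI : IsSemialgebraic ℚ {p : Fin 1 → ℝ | p 0 ∈ I}) (c : ℝ → ℝ)
    (hcs : IsSemialgebraicFunOn ℚ {p : Fin 1 → ℝ | p 0 ∈ I} (fun p => c (p 0))) :
    IsSemialgebraicMapOn ℚ {z : Fin (m + 1) → ℝ | Fin.init z ∈ S ∧ z (Fin.last m) ∈ I}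
      (fun z => Fin.snoc (Fin.init z) (c (z (Fin.last m)))) := by
  have hT := isSemialgebraic_lastCyl hS hI
  refine IsSemialgebraicMapOn.of_forall hT fun i => ?_
  refine Fin.lastCases ?_ (fun j => ?_) i
  · exact (isSemialgebraicFunOn_comp_last hT c hcs fun z hz => hz.2).congr fun z _ => by simp
  · exact (isSemialgebraicFunOn_apply hT (Fin.castSucc j)).congr fun z _ => by simp [Fin.init]

/-! ## Substitution along the last coordinate (rule 2) -/

/-- **Substitution along the last coordinate is a change-of-variables move.** Let `S ⊆ ℝᵐ` be
`ℚ`-semialgebraic, `I ⊆ ℝ` `ℚ`-semialgebraic, `c, c'` one-variable functions, `ℚ`-semialgebraic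
on `I`, with `c' t` the derivative of `c` at every `t ∈ I`, `c' > 0` and `c` injective on `I`, and
`J = c(I)`. For every representation `r'` on the cylinder `S × J` there is a representation `r` on
`S × I` with integrand `(y, t) ↦ r'.integrand (y, c t) · c' t`, and `[r] − [r']` is ONE instance of
Kontsevich–Zagier's rule (2) along `Ψ (y, t) = (y, c t)` (`det Ψ' = c'` by
`LinearMap.det_of_snoc_init`; the new integrand is integrable by
`MeasureTheory.integrableOn_image_iff_integrableOn_abs_det_fderiv_smul`).
[cite: KontsevichZagier2001, §1.2 rule (2)] -/
theorem exists_lastSubst {m : ℕ} {S : Set (Fin m → ℝ)} (hS : IsSemialgebraic ℚ S)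
    {I J : Set ℝ} (hI : IsSemialgebraic ℚ {p : Fin 1 → ℝ | p 0 ∈ I}) (c c' : ℝ → ℝ)
    (hcs : IsSemialgebraicFunOn ℚ {p : Fin 1 → ℝ | p 0 ∈ I} (fun p => c (p 0)))
    (hc's : IsSemialgebraicFunOn ℚ {p : Fin 1 → ℝ | p 0 ∈ I} (fun p => c' (p 0)))
    (hder : ∀ t ∈ I, HasDerivAt c (c' t) t) (hpos : ∀ t ∈ I, 0 < c' t) (hinj : InjOn c I)
    (hIJ : c '' I = J) (r' : KZ.IntegralRep (m + 1))
    (hr' : r'.domain = {z : Fin (m + 1) → ℝ | Fin.init z ∈ S ∧ z (Fin.last m) ∈ J}) :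
    ∃ r : KZ.IntegralRep (m + 1),
      r.domain = {z : Fin (m + 1) → ℝ | Fin.init z ∈ S ∧ z (Fin.last m) ∈ I} ∧
      (r.integrand = fun z =>
        r'.integrand (Fin.snoc (Fin.init z) (c (z (Fin.last m)))) * c' (z (Fin.last m))) ∧
      KZ.of r - KZ.of r' ∈ KZ.relations := by
  -- the source cylinder
  set T : Set (Fin (m + 1) → ℝ) := {z | Fin.init z ∈ S ∧ z (Fin.last m) ∈ I} with hT_def
  have hT : IsSemialgebraic ℚ T := isSemialgebraic_lastCyl hS hI
  have hTm : MeasurableSet T := IsSemialgebraic.measurableSet_holds hT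
  have hTI : ∀ z ∈ T, z (Fin.last m) ∈ I := fun z hz => hz.2
  -- the substitution and its derivative
  set Ψ : (Fin (m + 1) → ℝ) → (Fin (m + 1) → ℝ) := fun z =>
    Fin.snoc (Fin.init z) (c (z (Fin.last m))) with hΨ_def
  let lastL : (Fin (m + 1) → ℝ) →L[ℝ] ℝ := ContinuousLinearMap.proj (Fin.last m)
  let Ψ' : (Fin (m + 1) → ℝ) → (Fin (m + 1) → ℝ) →L[ℝ] (Fin (m + 1) → ℝ) := fun z =>
    ContinuousLinearMap.pi
      (Fin.lastCases (motive := fun _ => (Fin (m + 1) → ℝ) →L[ℝ] ℝ)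
        (c' (z (Fin.last m)) • lastL) (fun i => ContinuousLinearMap.proj (Fin.castSucc i)))
  have hΨ' : ∀ z w, Ψ' z w = Fin.snoc (Fin.init w) (c' (z (Fin.last m)) * w (Fin.last m)) := by
    intro z w
    funext i
    refine Fin.lastCases ?_ (fun j => ?_) i
    · simp [Ψ', lastL]
    · simp [Ψ', Fin.init]
  -- determinant
  have hdet : ∀ z, (Ψ' z).det = c' (z (Fin.last m)) := by
    intro z
    have h := LinearMap.det_of_snoc_init (Ψ' z : (Fin (m + 1) → ℝ) →ₗ[ℝ] (Fin (m + 1) → ℝ))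
      LinearMap.id (0 : (Fin m → ℝ) →ₗ[ℝ] ℝ) (c' (z (Fin.last m))) (fun w => by
        rw [ContinuousLinearMap.coe_coe, hΨ']
        simp)
    rw [LinearMap.det_id, mul_one] at h
    exact h
  -- derivative
  have hderiv : ∀ z ∈ T, HasFDerivAt Ψ (Ψ' z) z := by
    intro z hz
    rw [hasFDerivAt_pi']
    intro i
    refine Fin.lastCases ?_ (fun j => ?_) i
    · have hl : HasFDerivAt (fun x : Fin (m + 1) → ℝ => x (Fin.last m)) lastL z :=
        hasFDerivAt_apply (Fin.last m) z
      have h := (hder _ (hTI z hz)).comp_hasFDerivAt z hl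
      have hfun : (fun x => Ψ x (Fin.last m)) = c ∘ fun x : Fin (m + 1) → ℝ => x (Fin.last m) :=
        funext fun x => by simp [hΨ_def]
      rw [hfun]
      refine h.congr_fderiv (ContinuousLinearMap.ext fun w => ?_)
      simp [hΨ', lastL]
    · have hfun : (fun x => Ψ x (Fin.castSucc j)) = fun x => x (Fin.castSucc j) :=
        funext fun x => by simp [hΨ_def, Fin.init]
      rw [hfun]
      refine (hasFDerivAt_apply (Fin.castSucc j) z).congr_fderiv
        (ContinuousLinearMap.ext fun w => ?_)
      simp [hΨ', Fin.init]
  -- semialgebraicity of the substitution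
  have hc'T : IsSemialgebraicFunOn ℚ T (fun z => c' (z (Fin.last m))) :=
    isSemialgebraicFunOn_comp_last hT c' hc's hTI
  have hΨsa : IsSemialgebraicMapOn ℚ T Ψ := isSemialgebraicMapOn_lastSubst hS hI c hcs
  -- injectivity and image
  have hinjΨ : InjOn Ψ T := by
    intro z₁ hz₁ z₂ hz₂ h
    have hy : Fin.init z₁ = Fin.init z₂ := by simpa [hΨ_def] using congrArg Fin.init h
    have hl : c (z₁ (Fin.last m)) = c (z₂ (Fin.last m)) := by
      simpa [hΨ_def] using congrFun h (Fin.last m)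
    have hs : z₁ (Fin.last m) = z₂ (Fin.last m) := hinj (hTI _ hz₁) (hTI _ hz₂) hl
    rw [← Fin.snoc_init_self z₁, ← Fin.snoc_init_self z₂, hy, hs]
  have himage : Ψ '' T = {z : Fin (m + 1) → ℝ | Fin.init z ∈ S ∧ z (Fin.last m) ∈ J} := by
    ext w
    simp only [mem_image, mem_setOf_eq]
    constructor
    · rintro ⟨z, hz, rfl⟩
      refine ⟨by simpa [hΨ_def] using hz.1, ?_⟩
      rw [← hIJ]
      simp only [hΨ_def, Fin.snoc_last]
      exact mem_image_of_mem c hz.2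
    · rw [← hIJ]
      rintro ⟨hwS, t, ht, htw⟩
      refine ⟨Fin.snoc (Fin.init w) t, ⟨by simpa using hwS, by simpa using ht⟩, ?_⟩
      simp only [hΨ_def, Fin.init_snoc, Fin.snoc_last, htw]
      exact Fin.snoc_init_self w
  have hmaps : MapsTo Ψ T r'.domain := by rw [hr', ← himage]; exact mapsTo_image Ψ T
  -- the new integrand
  set g : (Fin (m + 1) → ℝ) → ℝ := fun z =>
    r'.integrand (Fin.snoc (Fin.init z) (c (z (Fin.last m)))) * c' (z (Fin.last m)) with hg_def
  have hgsa : IsSemialgebraicFunOn ℚ T g := by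
    have h := (IsSemialgebraicFunOn.comp_isSemialgebraicMapOn_holds
      r'.isSemialgebraicFunOn_integrand hΨsa hmaps).fun_mul hc'T
    exact h.congr fun z _ => by simp [hg_def, hΨ_def]
  have hgint : IntegrableOn g T := by
    have h := (integrableOn_image_iff_integrableOn_abs_det_fderiv_smul volume hTm
      (fun z hz => (hderiv z hz).hasFDerivWithinAt) hinjΨ r'.integrand).mp
      (by rw [himage, ← hr']; exact r'.integrableOn)
    refine h.congr_fun (fun z hz => ?_) hTm
    show |(Ψ' z).det| • r'.integrand (Ψ z) = g z
    rw [hdet, abs_of_pos (hpos _ (hTI z hz)), smul_eq_mul, mul_comm]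
  let r : KZ.IntegralRep (m + 1) := ⟨T, g, hT, hgsa, hgint⟩
  refine ⟨r, rfl, rfl, ?_⟩
  refine KZ.changeOfVariablesRel_subset_relations ⟨m + 1, r, r', Ψ, Ψ', hΨsa,
    fun z hz => (hderiv z hz).hasFDerivWithinAt, hinjΨ, hr'.trans himage.symm,
    fun z hz => ?_, rfl⟩
  show g z = r'.integrand (Ψ z) * |(Ψ' z).det|
  rw [hdet, abs_of_pos (hpos _ (hTI z hz))]

/-! ## The compactification `c t = (1 − t)⁻¹ − t⁻¹` of `(0,1)` onto `ℝ` -/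

/-- `c t = (1 − t)⁻¹ − t⁻¹` has derivative `(1 − t)⁻² + t⁻²` at every `t ∈ (0,1)`. [folklore] -/
theorem hasDerivAt_compactify {t : ℝ} (ht : t ∈ Ioo (0:ℝ) 1) :
    HasDerivAt (fun s : ℝ => (1 - s)⁻¹ - s⁻¹) (((1 - t) ^ 2)⁻¹ + (t ^ 2)⁻¹) t := by
  have h1 : (1 - t) ≠ 0 := (sub_pos.2 ht.2).ne'
  have h0 : t ≠ 0 := ht.1.ne'
  have ha := ((hasDerivAt_id' t).const_sub 1).fun_inv h1
  have hb := hasDerivAt_inv h0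
  exact (ha.fun_sub hb).congr_deriv (by ring)

/-- `c` is strictly increasing on `(0,1)` (both `(1 − t)⁻¹` and `−t⁻¹` are). [folklore] -/
theorem strictMonoOn_compactify : StrictMonoOn (fun s : ℝ => (1 - s)⁻¹ - s⁻¹) (Ioo (0:ℝ) 1) := by
  intro s hs t ht hst
  have ha : (1 - s)⁻¹ < (1 - t)⁻¹ := (inv_lt_inv₀ (sub_pos.2 hs.2) (sub_pos.2 ht.2)).2 (by linarith)
  have hb : t⁻¹ < s⁻¹ := (inv_lt_inv₀ ht.1 hs.1).2 hst
  show (1 - s)⁻¹ - s⁻¹ < (1 - t)⁻¹ - t⁻¹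
  linarith

/-- `c` maps `(0,1)` ONTO `ℝ`: the preimage of `y` is `2/(2 − y + √(y² + 4)) ∈ (0,1)`. [folklore] -/
theorem image_compactify : (fun s : ℝ => (1 - s)⁻¹ - s⁻¹) '' Ioo (0:ℝ) 1 = univ := by
  refine eq_univ_of_forall fun y => ?_
  have hq2 : Real.sqrt (y ^ 2 + 4) ^ 2 = y ^ 2 + 4 := Real.sq_sqrt (by positivity)
  have hyq : y < Real.sqrt (y ^ 2 + 4) := Real.lt_sqrt_of_sq_lt (by linarith)
  have hd0 : 0 < 2 - y + Real.sqrt (y ^ 2 + 4) := by linarith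
  refine ⟨2 / (2 - y + Real.sqrt (y ^ 2 + 4)),
    ⟨div_pos two_pos hd0, (div_lt_one hd0).2 (by linarith)⟩, ?_⟩
  have h1 : 1 - 2 / (2 - y + Real.sqrt (y ^ 2 + 4)) =
      (Real.sqrt (y ^ 2 + 4) - y) / (2 - y + Real.sqrt (y ^ 2 + 4)) := by
    field_simp
    ring
  show (1 - 2 / (2 - y + Real.sqrt (y ^ 2 + 4)))⁻¹ - (2 / (2 - y + Real.sqrt (y ^ 2 + 4)))⁻¹ = y
  rw [h1, inv_div, inv_div, div_sub_div _ _ (by linarith : Real.sqrt (y ^ 2 + 4) - y ≠ 0)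
    two_ne_zero, div_eq_iff (mul_ne_zero (by linarith : Real.sqrt (y ^ 2 + 4) - y ≠ 0)
    two_ne_zero)]
  linear_combination (-1 : ℝ) * hq2

/-- `c t → −∞` as `t → 0⁺`. [folklore] -/
theorem tendsto_compactify_zero :
    Tendsto (fun s : ℝ => (1 - s)⁻¹ - s⁻¹) (𝓝[>] 0) atBot := by
  have h1 : Tendsto (fun s : ℝ => (1 - s)⁻¹) (𝓝[>] 0) (𝓝 1) := by
    have hc : ContinuousAt (fun s : ℝ => (1 - s)⁻¹) 0 :=
      ((continuous_const.sub continuous_id).continuousAt).inv₀ (by norm_num)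
    have := hc.tendsto
    simp only [sub_zero, inv_one] at this
    exact this.mono_left nhdsWithin_le_nhds
  have h2 : Tendsto (fun s : ℝ => -s⁻¹) (𝓝[>] 0) atBot :=
    tendsto_neg_atTop_atBot.comp tendsto_inv_nhdsGT_zero
  simpa [sub_eq_add_neg] using h1.add_atBot h2

/-- `c t → +∞` as `t → 1⁻`. [folklore] -/
theorem tendsto_compactify_one :
    Tendsto (fun s : ℝ => (1 - s)⁻¹ - s⁻¹) (𝓝[<] 1) atTop := by
  have h1 : Tendsto (fun s : ℝ => (1 - s)⁻¹) (𝓝[<] 1) atTop := by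
    refine tendsto_inv_nhdsGT_zero.comp ?_
    rw [tendsto_nhdsWithin_iff]
    constructor
    · have : Tendsto (fun s : ℝ => 1 - s) (𝓝 1) (𝓝 ((1:ℝ) - 1)) :=
        ((continuous_const.sub continuous_id).tendsto (1:ℝ))
      rw [sub_self] at this
      exact this.mono_left nhdsWithin_le_nhds
    · filter_upwards [self_mem_nhdsWithin] with s hs
      exact sub_pos.2 (Set.mem_Iio.1 hs)
  have h2 : Tendsto (fun s : ℝ => -s⁻¹) (𝓝[<] 1) (𝓝 (-1)) := by
    have hc : ContinuousAt (fun s : ℝ => -s⁻¹) 1 := (continuousAt_id.inv₀ one_ne_zero).neg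
    have := hc.tendsto
    simp only [inv_one] at this
    exact this.mono_left nhdsWithin_le_nhds
  simpa [sub_eq_add_neg] using h1.atTop_add h2

end Engine

/-! ## Registered auxiliary stub: a band with fibre primitive vanishing at both ends (rules 3, 1) -/

/-- **Newton–Leibniz with a primitive vanishing at both ends.** Let `r` be a representation on
the open band `S × (0,1)` over a `ℚ`-semialgebraic base `S ⊆ ℝᵐ`, and `W` a `ℚ`-semialgebraic
function on that band such that on each fibre `t ↦ W (y, t)` has derivative `r.integrand (y, t)`
on `(0,1)` and tends to `0` as `t → 0⁺` and as `t → 1⁻`. Then `[r] ∈ KZ.relations`: ONE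
Newton–Leibniz move along the last coordinate (rule (3)) with the primitive `W` extended by zero
to the closed band `S × [0,1]` and edges `a ≡ 0 ≤ b ≡ 1` lands on the base integrand
`W(·,1) − W(·,0) = 0` (a zero representation), and the closed and open bands differ by two null
faces (rule (1)). [cite: KontsevichZagier2001, §1.2 rule (3)] -/
theorem stub_engineAux :
    ∀ {m : ℕ} {S : Set (Fin m → ℝ)}, IsSemialgebraic ℚ S → ∀ (r : KZ.IntegralRep (m + 1)),
      r.domain = {z : Fin (m + 1) → ℝ | Fin.init z ∈ S ∧ z (Fin.last m) ∈ Ioo (0:ℝ) 1} →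
      ∀ (W : (Fin (m + 1) → ℝ) → ℝ), IsSemialgebraicFunOn ℚ r.domain W →
      (∀ y ∈ S, ∀ t ∈ Ioo (0:ℝ) 1,
        HasDerivAt (fun s : ℝ => W (Fin.snoc y s)) (r.integrand (Fin.snoc y t)) t) →
      (∀ y ∈ S, Tendsto (fun s : ℝ => W (Fin.snoc y s)) (𝓝[>] 0) (𝓝 0)) →
      (∀ y ∈ S, Tendsto (fun s : ℝ => W (Fin.snoc y s)) (𝓝[<] 1) (𝓝 0)) →
      KZ.of r ∈ KZ.relations := by
  intro m S hS r hr W hW hder h0 h1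
  have ha : IsSemialgebraicFunOn ℚ S (fun _ => (0:ℝ)) := by
    simpa using isSemialgebraicFunOn_ratCast hS 0
  have hb : IsSemialgebraicFunOn ℚ S (fun _ => (1:ℝ)) := by
    simpa using isSemialgebraicFunOn_ratCast hS 1
  have hband : IsSemialgebraic ℚ (KZlog.band S (fun _ => 0) (fun _ => 1)) :=
    KZlog.isSemialgebraic_band ha hb
  have hrm : MeasurableSet r.domain := KZ.IntegralRep.measurableSet_domain_holds r
  have hsub : r.domain ⊆ KZlog.band S (fun _ => 0) (fun _ => 1) := by
    rw [hr]; exact fun z hz => ⟨hz.1, hz.2.1.le, hz.2.2.le⟩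
  have hsnoc : ∀ (y : Fin m → ℝ) (t : ℝ),
      (Fin.snoc y t : Fin (m + 1) → ℝ) ∈ r.domain ↔ y ∈ S ∧ t ∈ Ioo (0:ℝ) 1 := by
    intro y t; rw [hr]; simp
  -- the band integrand and the primitive, extended by zero
  set G : (Fin (m + 1) → ℝ) → ℝ := r.domain.indicator r.integrand with hG
  set F : (Fin (m + 1) → ℝ) → ℝ := r.domain.indicator W with hF
  have hext : ∀ {f : (Fin (m + 1) → ℝ) → ℝ}, IsSemialgebraicFunOn ℚ r.domain f →
      IsSemialgebraicFunOn ℚ (KZlog.band S (fun _ => 0) (fun _ => 1)) (r.domain.indicator f) := by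
    intro f hf
    have hz : IsSemialgebraicFunOn ℚ (KZlog.band S (fun _ => 0) (fun _ => 1) \ r.domain)
        (fun _ => (0 : ℝ)) := by
      simpa using isSemialgebraicFunOn_ratCast (hband.diff r.isSemialgebraic_domain) 0
    have h := IsSemialgebraicFunOn.union hf hz (fun x hx => indicator_of_mem hx f)
      (fun x hx => indicator_of_notMem hx.2 f)
    rwa [union_sdiff_cancel hsub] at h
  have hGsa : IsSemialgebraicFunOn ℚ (KZlog.band S (fun _ => 0) (fun _ => 1)) G := hext
    r.isSemialgebraicFunOn_integrand
  have hFsa : IsSemialgebraicFunOn ℚ (KZlog.band S (fun _ => 0) (fun _ => 1)) F := hext hW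
  have hGint : IntegrableOn G (KZlog.band S (fun _ => 0) (fun _ => 1)) :=
    ((integrable_indicator_iff hrm).2 r.integrableOn).integrableOn
  let R : KZ.IntegralRep (m + 1) := ⟨KZlog.band S (fun _ => 0) (fun _ => 1), G, hband, hGsa, hGint⟩
  obtain ⟨Z0, hZ0d, hZ0i⟩ := KZ.exists_zeroRep hS
  -- fibres of the extended primitive
  have hFfib : ∀ y ∈ S, ∀ t, F (Fin.snoc y t) =
      (Ioo (0:ℝ) 1).indicator (fun s : ℝ => W (Fin.snoc y s)) t := by
    intro y hy t
    by_cases ht : t ∈ Ioo (0:ℝ) 1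
    · rw [indicator_of_mem ht, hF, indicator_of_mem ((hsnoc y t).2 ⟨hy, ht⟩)]
    · rw [indicator_of_notMem ht, hF, indicator_of_notMem (fun h => ht ((hsnoc y t).1 h).2)]
  -- rule (3): `[closed band, G] − [S, 0]`
  have hNL : KZ.of R - KZ.of Z0 ∈ KZ.relations := by
    refine KZ.newtonLeibnizRel_subset_relations ⟨m, R, Z0, fun _ => 0, fun _ => 1, F, hFsa,
      by rw [hZ0d]; exact ha, by rw [hZ0d]; exact hb, fun _ _ => zero_le_one, by rw [hZ0d]; rfl,
      fun y hy => ?_, fun y hy t ht => ?_, fun y hy => ?_, rfl⟩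
    · -- continuity on the closed fibre
      rw [hZ0d] at hy
      show ContinuousOn (fun t : ℝ => F (Fin.snoc y t)) (Icc 0 1)
      have hfun : (fun t : ℝ => F (Fin.snoc y t)) =
          (Ioo (0:ℝ) 1).indicator (fun s : ℝ => W (Fin.snoc y s)) := funext (hFfib y hy)
      rw [hfun]
      intro t ht
      rcases ht.1.eq_or_lt with h | ht0
      · -- `t = 0`
        subst h
        have hc : ContinuousWithinAt ((Ioo (0:ℝ) 1).indicator fun s : ℝ => W (Fin.snoc y s))
            (Ioi 0) 0 := by
          show Tendsto _ (𝓝[>] (0:ℝ)) _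
          rw [indicator_of_notMem (fun h : (0:ℝ) ∈ Ioo (0:ℝ) 1 => lt_irrefl _ h.1)]
          refine (h0 y hy).congr' ?_
          filter_upwards [Ioo_mem_nhdsGT (zero_lt_one' ℝ)] with s hs
          rw [indicator_of_mem hs]
        exact (continuousWithinAt_Ioi_iff_Ici.mp hc).mono Icc_subset_Ici_self
      rcases ht.2.eq_or_lt with h | ht1
      · -- `t = 1`
        subst h
        have hc : ContinuousWithinAt ((Ioo (0:ℝ) 1).indicator fun s : ℝ => W (Fin.snoc y s))
            (Iio 1) 1 := by
          show Tendsto _ (𝓝[<] (1:ℝ)) _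
          rw [indicator_of_notMem (fun h : (1:ℝ) ∈ Ioo (0:ℝ) 1 => lt_irrefl _ h.2)]
          refine (h1 y hy).congr' ?_
          filter_upwards [Ioo_mem_nhdsLT (zero_lt_one' ℝ)] with s hs
          rw [indicator_of_mem hs]
        exact (continuousWithinAt_Iio_iff_Iic.mp hc).mono Icc_subset_Iic_self
      -- interior point
      have hto : t ∈ Ioo (0:ℝ) 1 := ⟨ht0, ht1⟩
      have hc : ContinuousAt (fun s : ℝ => W (Fin.snoc y s)) t := (hder y hy t hto).continuousAt
      refine (hc.congr_of_eventuallyEq ?_).continuousWithinAt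
      filter_upwards [Ioo_mem_nhds ht0 ht1] with s hs
      rw [indicator_of_mem hs]
    · -- derivative on the open fibre
      rw [hZ0d] at hy
      show HasDerivAt (fun s : ℝ => F (Fin.snoc y s)) (G (Fin.snoc y t)) t
      rw [hG, indicator_of_mem ((hsnoc y t).2 ⟨hy, ht⟩)]
      refine (hder y hy t ht).congr_of_eventuallyEq ?_
      filter_upwards [Ioo_mem_nhds ht.1 ht.2] with s hs
      rw [hF, indicator_of_mem ((hsnoc y s).2 ⟨hy, hs⟩)]
    · -- the base integrand vanishes
      rw [hZ0i]
      show (0 : ℝ) = F (Fin.snoc y 1) - F (Fin.snoc y 0)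
      rw [hF, indicator_of_notMem (fun h => lt_irrefl _ ((hsnoc y 1).1 h).2.2),
        indicator_of_notMem (fun h => lt_irrefl _ ((hsnoc y 0).1 h).2.1), sub_zero]
  have hZ0 : KZ.of Z0 ∈ KZ.relations :=
    KZ.of_mem_relations_of_eqOn_zero Z0 (by rw [hZ0i]; exact fun _ _ => rfl)
  -- rule (1): closed versus open band
  obtain ⟨r₂, hr₂d, hr₂i, hr₂⟩ := KZ.of_sub_of_restrict_openBand_mem_relations
    (B := S) (a := fun _ => (0:ℝ)) (b := fun _ => (1:ℝ)) ha hb R rfl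
  have hcongr : KZ.of r₂ - KZ.of r ∈ KZ.relations := by
    refine KZ.of_sub_of_mem_relations_of_eqOn (by rw [hr, hr₂d]; rfl) fun z hz => ?_
    rw [hr₂i]
    show G z = r.integrand z
    rw [hr₂d] at hz
    have hz' : z ∈ r.domain := by rw [hr]; exact hz
    rw [hG, indicator_of_mem hz']
  have : KZ.of r = (KZ.of R - KZ.of Z0) + KZ.of Z0 - (KZ.of R - KZ.of r₂) -
      (KZ.of r₂ - KZ.of r) := by abel
  rw [this]
  exact KZ.relations.sub_mem (KZ.relations.sub_mem (KZ.relations.add_mem hNL hZ0) hr₂) hcongr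


end Summit.KontsevichZagierPeriods.UnfoldedStokes.HyperellipticRiemannRelationLine
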